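import Summits.HodgeConjecture.CorCM.Census.OcticWeil13PairParts
import Summits.HodgeConjecture.CorCM.OcticWeilMixedFrameTransfer
import HarnessLib

/-!
# COR-CM — two `(1,3)`-types over one octic CM field: frame transfer to the kernel census `Census/OcticWeil13Pair`, and the
# type count of the `(2,2)`-slot

Cell `pub-hodgecm2` (COR-CM), seat b30 gen 21 (2026-08-22); count-neutral own lane OCTIC-WEIL-EIGHTFOLD.  Theorems only; no named
fact, no `sorry`.  The four-slot index set `orbitSlots i₀ i₁ = (k, F, F, F)` and model map `toPt₃ e τ` of ORBIT
(`CorCM/OcticWeilOrbitFrameTransfer.lean`) are reused BY NAME; the atoms are `A₄ = (E, B, B'₁, B'₂)`: slot `1` the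
`(2,2)`-type `Φ_{I_0}` (`s ∈ Φ ⟺ (e s).2 = [(e s).1 ∈ {0,1}]`), slot `2` the `(1,3)`-type at position `0`
(`s ∈ Φ'₁ ⟺ (e s).2 = [(e s).1 = 0]`), slot `3` the `(1,3)`-type at position `2` (`s ∈ Φ'₂ ⟺ (e s).2 = [(e s).1 = 2]`) — in one
line: `s ∈ Φ₄ (m+1) ⟺ (e s).2 = signTabP 0 m (e s).1`.

* §1 `modelBalancedP_of_isGaloisBalancedAlg` — an `Aut(ℂ)`-balanced weight of `X = ⨁_j A₄(κ j)` is a balanced configuration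
  of `Census/OcticWeil13Pair` (`ModelBalancedP`), for every slot map `κ`, provided every even permutation of the pairs is
  realised in `Aut(ℂ)` fixing `τ` (`hgal`; from `2`-transitivity by `OcticWeilOrbit.hgal_of_h2t`, from `B` simple by Dodson,
  `OcticWeilFourfold.twoTransitive_of_isSimple`);
* §2 `typeCount_eq_two_of_frameP` — the slot-`1` type has `k`-signature `(2,2)` (feeds the ORBIT/MIXED Weil-part lemma
  `OcticWeilMixed.weightClassesAlg_le_algebraicClasses_of_isWeil₃Part_slot` at `m = 0`); `typeCount_of_frameP_one/_two` — the
  `(1,3)`-slots have exactly one member over `τ`.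
HONEST FRAMING: nothing about the Hodge conjecture is concluded in this file; `HC_CM` is not asserted.
[cite: Pohlmann1968, Thm 1] [cite: GaoUllmo2025, Thm 3.1] [cite: Dodson1984, §3.3.2 Theorem]

## References
* [Pohlmann1968] Ann. of Math. 88 (1968), Thm 1.  [GaoUllmo2025] J. Inst. Math. Jussieu 25 (2025), Thm 3.1 (3.2).
  [Dodson1984] Trans. AMS 283 (1984), §3.3.2.  [Deligne1982HodgeCycles] LNM 900 (1982), §4 Prop. 4.4.
-/

noncomputable section

open CategoryTheory CategoryTheory.Limits NumberField

namespace Summit.HodgeConjecture.CorCM.OcticWeil13Pair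

open Literature.AlgebraicGeometry Literature.AlgebraicGeometry.Motives Literature.AlgebraicGeometry.HodgeTheory
open Literature.AlgebraicGeometry.ComplexMultiplication (IsCMTypeRealisation)
open Literature.AlgebraicGeometry.Pohlmann1968
open Literature.NumberTheory.ComplexMultiplication
open Summit.HodgeConjecture.CorCM.Census.OcticWeilOrbit (Pt₃ permTab signTab)
open Summit.HodgeConjecture.CorCM.Census.OcticWeil13Pair (signTabP signTabP_zero signTabP_one signTabP_two phiP inl_mem_phiP
  inr_mem_phiP ModelBalancedP)
open Summit.HodgeConjecture.CorCM.OcticWeilOrbit (orbitSlots toPt₃ toPt₃_zero toPt₃_succ sigma_cases₃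
  apply_comp_eq_of_realises₃ comp_eq_tau_iff_of_realises₃)
open Summit.HodgeConjecture.CorCM.DihedralSexticPairCurvePowers (ncard_sep_eq_card_filter)
open Summit.HodgeConjecture.CorCM.DihedralSexticPair (card_filter_equiv_mem)

open scoped Classical Pointwise

/-! ## §1 Frame transfer -/

section Transfer

variable {I : Type} {Kf : I → Type} [∀ i, Field (Kf i)]
  {i₀ i₁ : I} {e : (Kf i₁ →+* ℂ) ≃ Fin 4 × Bool} {τ : Kf i₀ →+* ℂ}
  (hττ : ComplexEmbedding.conjugate τ ≠ τ) (hk : ∀ σ : Kf i₀ →+* ℂ, σ = τ ∨ σ = ComplexEmbedding.conjugate τ)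
  {i : Kf i₀ →+* Kf i₁}
  (he_sign : ∀ s : Kf i₁ →+* ℂ, (e s).2 = true ↔ s.comp i = τ)
  (he_conj : ∀ s : Kf i₁ →+* ℂ, e (ComplexEmbedding.conjugate s) = ((e s).1, !(e s).2))
  {Φ₄ : ∀ j : Fin 4, CMType (Kf (orbitSlots i₀ i₁ j))}
  (hΦ : ∀ (m : Fin 3) (s : Kf i₁ →+* ℂ), s ∈ (Φ₄ m.succ).1 ↔ (e s).2 = signTabP 0 m (e s).1)
  (hΨ : ∀ σ : Kf i₀ →+* ℂ, σ ∈ (Φ₄ 0).1 ↔ σ = τ)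

/-- The table read through row `0` (the identity permutation): `signTabP 0 m (permTab r a) = signTabP r m a`. [folklore] -/
theorem signTabP_zero_permTab : ∀ (r : Fin 12) (m : Fin 3) (a : Fin 4), signTabP 0 m (permTab r a) = signTabP r m a := by
  unfold signTabP Census.OcticWeilMixed.sixTab
  decide +kernel

include he_conj hΦ in
/-- **How a realiser of `permTab r` acts on a fourfold slot**: `ρ ∘ s ∈ Φ₄ (m+1) ⟺ inr (m, e s) ∈ phiP r`.
[cite: GaoUllmo2025, Thm 3.1 (3.2)] [cite: Dodson1984, §3.1.1] -/
theorem comp_mem_iff_of_realisesP [NumberField (Kf i₁)] [IsCMField (Kf i₁)] (ρ : ℂ ≃+* ℂ) {r : Fin 12}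
    (hρ : ∀ a : Fin 4, (ρ : ℂ →+* ℂ).comp (e.symm (a, true)) = e.symm (permTab r a, true)) (m : Fin 3)
    (s : Kf i₁ →+* ℂ) : (ρ : ℂ →+* ℂ).comp s ∈ (Φ₄ m.succ).1 ↔ (Sum.inr (m, e s) : Pt₃) ∈ phiP r := by
  rw [hΦ, apply_comp_eq_of_realises₃ he_conj ρ hρ s, inr_mem_phiP, signTabP_zero_permTab]

include hττ hk he_sign he_conj hΦ hΨ in
/-- **Membership read in the frame**: for a realiser `ρ` of `permTab r`, `ρ ∘ x ∈ Φ₄ ↔ toPt₃ x ∈ phiP r`.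
[cite: GaoUllmo2025, Thm 3.1 (3.2)] -/
theorem comp_mem_iff_toPt₃_memP [NumberField (Kf i₁)] [IsCMField (Kf i₁)] {ρ : ℂ ≃+* ℂ} {r : Fin 12}
    (hρ : ∀ a : Fin 4, (ρ : ℂ →+* ℂ).comp (e.symm (a, true)) = e.symm (permTab r a, true))
    (x : (j : Fin 4) × (Kf (orbitSlots i₀ i₁ j) →+* ℂ)) :
    (ρ : ℂ →+* ℂ).comp x.2 ∈ (Φ₄ x.1).1 ↔ toPt₃ e τ x ∈ phiP r := by
  rcases sigma_cases₃ x with ⟨σ, rfl⟩ | ⟨m, s, rfl⟩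
  · change (ρ : ℂ →+* ℂ).comp σ ∈ (Φ₄ 0).1 ↔ _
    rw [hΨ, toPt₃_zero, inl_mem_phiP, comp_eq_tau_iff_of_realises₃ hττ hk he_sign ρ hρ σ]
    exact ⟨fun h => decide_eq_true h, fun h => of_decide_eq_true h⟩
  · exact comp_mem_iff_of_realisesP he_conj hΦ ρ hρ m s

variable {N : ℕ} (κ : Fin N → Fin 4)

include hττ hk he_sign he_conj hΦ hΨ in
/-- **FRAME TRANSFER**: an `Aut(ℂ)`-balanced weight of `X = ⨁_j A₄(κ j)` is a balanced configuration of `Census/OcticWeil13Pair`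
(`ModelBalancedP`: the twelve `A₄`-equations) under `v = toPt₃ e τ ∘ P`, for every slot map `κ`, provided every even
permutation of the pairs is realised in `Aut(ℂ)` (`hgal`). [cite: GaoUllmo2025, Thm 3.1 (3.2)] [cite: Pohlmann1968, Thm 1]
[cite: Dodson1984, §3.3.2 Theorem] -/
theorem modelBalancedP_of_isGaloisBalancedAlg [NumberField (Kf i₁)] [IsCMField (Kf i₁)]
    (hgal : ∀ r : Fin 12, ∃ ρ : ℂ ≃+* ℂ,
      ∀ a : Fin 4, (ρ : ℂ →+* ℂ).comp (e.symm (a, true)) = e.symm (permTab r a, true))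
    {S : Finset ((j : Fin N) × (Kf (orbitSlots i₀ i₁ (κ j)) →+* ℂ))}
    (hS : IsGaloisBalancedAlg (K := fun j => Kf (orbitSlots i₀ i₁ (κ j))) (fun j => Φ₄ (κ j)) S) :
    ModelBalancedP (fun x => toPt₃ e τ ((Sigma.map κ (fun _ => id) :
      ((j : Fin N) × (Kf (orbitSlots i₀ i₁ (κ j)) →+* ℂ)) → ((m : Fin 4) × (Kf (orbitSlots i₀ i₁ m) →+* ℂ))) x)) S := by
  intro r
  beta_reduce
  obtain ⟨ρ, hρ⟩ := hgal r
  have h := hS ρ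
  rw [ncard_sep_eq_card_filter, ncard_sep_eq_card_filter] at h
  have key : ∀ x : (j : Fin N) × (Kf (orbitSlots i₀ i₁ (κ j)) →+* ℂ),
      (ρ : ℂ →+* ℂ).comp x.2 ∈ (Φ₄ (κ x.1)).1 ↔ toPt₃ e τ ((Sigma.map κ (fun _ => id) :
        ((j : Fin N) × (Kf (orbitSlots i₀ i₁ (κ j)) →+* ℂ)) → ((m : Fin 4) × (Kf (orbitSlots i₀ i₁ m) →+* ℂ))) x)
          ∈ phiP r :=
    fun x => comp_mem_iff_toPt₃_memP hττ hk he_sign he_conj hΦ hΨ hρ ⟨κ x.1, x.2⟩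
  rw [Finset.filter_congr fun x _ => key x, Finset.filter_congr fun x _ => (key x).not] at h
  have htot := Finset.card_filter_add_card_filter_not
    (s := S) (fun x => toPt₃ e τ ((Sigma.map κ (fun _ => id) :
        ((j : Fin N) × (Kf (orbitSlots i₀ i₁ (κ j)) →+* ℂ)) → ((m : Fin 4) × (Kf (orbitSlots i₀ i₁ m) →+* ℂ))) x)
          ∈ phiP r)
  omega

end Transfer

/-! ## §2 Type counts -/

section Counts

variable {I : Type} {Kf : I → Type} [∀ i, Field (Kf i)] [∀ i, NumberField (Kf i)] [∀ i, IsCMField (Kf i)]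
  {i₀ i₁ : I} {e : (Kf i₁ →+* ℂ) ≃ Fin 4 × Bool} {τ : Kf i₀ →+* ℂ} {i : Kf i₀ →+* Kf i₁}

omit [∀ i, IsCMField (Kf i)] in
/-- **The slot-`1` type has `k`-signature `(2,2)`**: for `s ∈ Φ ⟺ (e s).2 = signTabP 0 0 (e s).1` every embedding `τ'` of `k`
has `#{s ∈ Φ | s ∘ i = τ'} = 2` (ORBIT's `typeCount_eq_two_of_frame₃` at `m = 0`: `signTabP 0 0 = signTab 0 0`).
[cite: Deligne1982HodgeCycles, §4 Prop. 4.4] -/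
theorem typeCount_eq_two_of_frameP [∀ i, IsCMField (Kf i)] (h2 : Module.finrank ℚ (Kf i₀) = 2)
    (he_sign : ∀ s : Kf i₁ →+* ℂ, (e s).2 = true ↔ s.comp i = τ)
    {Φ : CMType (Kf i₁)} (hΦ : ∀ s : Kf i₁ →+* ℂ, s ∈ Φ.1 ↔ (e s).2 = signTabP 0 0 (e s).1) (τ' : Kf i₀ →+* ℂ) :
    (Finset.univ.filter fun s : Kf i₁ →+* ℂ => s.comp i = τ' ∧ s ∈ Φ.1).card = 2 :=
  OcticWeilOrbit.typeCount_eq_two_of_frame₃ h2 he_sign 0 (fun s => by rw [hΦ, signTabP_zero]) τ'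

end Counts

section Readings

variable {I : Type} {Kf : I → Type} [∀ i, Field (Kf i)] [∀ i, NumberField (Kf i)]
  {i₀ i₁ : I} {e : (Kf i₁ →+* ℂ) ≃ Fin 4 × Bool} {τ : Kf i₀ →+* ℂ} {i : Kf i₀ →+* Kf i₁}

/-- **A `(1,3)`-slot has exactly ONE member over `τ`**: for `s ∈ Φ ⟺ (e s).2 = [(e s).1 = c]` the members of `Φ` over `τ`
are `e⁻¹(c, true)` alone. [cite: Deligne1982HodgeCycles, §4 Prop. 4.4] -/
theorem typeCount_eq_one_of_frame13 (he_sign : ∀ s : Kf i₁ →+* ℂ, (e s).2 = true ↔ s.comp i = τ) (c : Fin 4)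
    {Φ : CMType (Kf i₁)} (hΦ : ∀ s : Kf i₁ →+* ℂ, s ∈ Φ.1 ↔ (e s).2 = decide ((e s).1 = c)) :
    (Finset.univ.filter fun s : Kf i₁ →+* ℂ => s.comp i = τ ∧ s ∈ Φ.1).card = 1 := by
  rw [Finset.card_eq_one]
  refine ⟨e.symm (c, true), ?_⟩
  ext s
  simp only [Finset.mem_filter, Finset.mem_univ, true_and, Finset.mem_singleton]
  constructor
  · rintro ⟨hs, hΦs⟩
    have h2 : (e s).2 = true := (he_sign s).2 hs
    rw [hΦ, h2] at hΦs
    have h1 : (e s).1 = c := of_decide_eq_true hΦs.symm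
    apply e.injective
    rw [Equiv.apply_symm_apply]
    ext <;> simp [h1, h2]
  · rintro rfl
    refine ⟨(he_sign _).1 (by rw [Equiv.apply_symm_apply]), ?_⟩
    rw [hΦ, Equiv.apply_symm_apply]
    simp

omit [∀ i, NumberField (Kf i)] in
/-- The slot-`2` reading in position form: `s ∈ Φ₄ 2 ⟺ (e s).2 = [(e s).1 = 0]`. [folklore] -/
theorem mem_iff_of_frameP_one {Φ₄ : ∀ j : Fin 4, CMType (Kf (orbitSlots i₀ i₁ j))}
    (hΦ : ∀ (m : Fin 3) (s : Kf i₁ →+* ℂ), s ∈ (Φ₄ m.succ).1 ↔ (e s).2 = signTabP 0 m (e s).1) (s : Kf i₁ →+* ℂ) :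
    s ∈ (Φ₄ (1 : Fin 3).succ).1 ↔ (e s).2 = decide ((e s).1 = 0) := by
  refine (hΦ 1 s).trans ?_
  rw [signTabP_one, Census.OcticWeilOrbit.permTab_facts.2.2, id]

omit [∀ i, NumberField (Kf i)] in
/-- The slot-`3` reading in position form: `s ∈ Φ₄ 3 ⟺ (e s).2 = [(e s).1 = 2]`. [folklore] -/
theorem mem_iff_of_frameP_two {Φ₄ : ∀ j : Fin 4, CMType (Kf (orbitSlots i₀ i₁ j))}
    (hΦ : ∀ (m : Fin 3) (s : Kf i₁ →+* ℂ), s ∈ (Φ₄ m.succ).1 ↔ (e s).2 = signTabP 0 m (e s).1) (s : Kf i₁ →+* ℂ) :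
    s ∈ (Φ₄ (2 : Fin 3).succ).1 ↔ (e s).2 = decide ((e s).1 = 2) := by
  refine (hΦ 2 s).trans ?_
  rw [signTabP_two, Census.OcticWeilOrbit.permTab_facts.2.2, id]

omit [∀ i, NumberField (Kf i)] in
/-- The slot-`1` reading in ORBIT form: `s ∈ Φ₄ 1 ⟺ (e s).2 = signTab 0 0 (e s).1`. [folklore] -/
theorem mem_iff_of_frameP_zero {Φ₄ : ∀ j : Fin 4, CMType (Kf (orbitSlots i₀ i₁ j))}
    (hΦ : ∀ (m : Fin 3) (s : Kf i₁ →+* ℂ), s ∈ (Φ₄ m.succ).1 ↔ (e s).2 = signTabP 0 m (e s).1) (s : Kf i₁ →+* ℂ) :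
    s ∈ (Φ₄ (0 : Fin 3).succ).1 ↔ (e s).2 = signTab 0 0 (e s).1 :=
  (hΦ 0 s).trans (by rw [signTabP_zero])

end Readings


end Summit.HodgeConjecture.CorCM.OcticWeil13Pair

end
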